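import Summits.AtomisticToContinuum.FouriersLaw.Theorems.BondHeatUncertaintyBoundedResponseBathHeatTwistB
import HarnessLib

/-!
# BondHeatUncertainty / BoundedResponse — «DCBand» addendum «Twist», part C (§T4): ★ THE TWISTED HEAT-PROXY VARIANCE IDENTITY

`pinnedChain_twistedHeatProxy_sq_eq`: for a momentum-odd `j`, momentum-even `e`, `φ` with the Dynkin identity `P_r e − e = ∫₀ʳ P_s(φ − j)ds`
(so `Le = φ − j`), every `ω` and `t ≥ 0`,
`E[(∫₀ᵗcos(ωs)j(z_s)ds + ω∫₀ᵗsin(ωs)e(z_s)ds + cos(ωt)e(z_t) − e(z_0))² + (∫₀ᵗsin(ωs)j(z_s)ds − ω∫₀ᵗcos(ωs)e(z_s)ds + sin(ωt)e(z_t))²]`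
`  = 2t⟪e, j − φ⟫ − 2∫₀ᵗ(t − r)cos(ωr)⟪φ,P_r φ⟫dr`
— the `ω`-twist of NODE 107's `pinnedChain_heatProxy_sq_eq` (fifteen moments, the weighted Dynkin identity for the `⟪·,P Le⟫` terms, parity,
and the trigonometric recombination `cos(ωt)∫cos(ωs)g(t−s) + sin(ωt)∫sin(ωs)g(t−s) = ∫cos(ωs)g(s)`).
(decomp-a2c lens-1 g117, NODE 117 «DCBand» addendum; part 3 of 4; imports part B `…BathHeatTwistB`)

No `sorry`, no new axioms, no new definitions.
-/

noncomputable section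

open MeasureTheory ProbabilityTheory Filter Topology Set Function
open scoped NNReal ENNReal
open Literature.MathematicalPhysics.KineticTheory.HeatConduction
open Literature.MathematicalPhysics.KineticTheory OscillatorChain
open Literature.Probability.Process
open Summit.AtomisticToContinuum.FouriersLaw.Theorems.SubdiffusiveBondHeat
open Summit.AtomisticToContinuum.FouriersLaw.Theorems.SubdiffusiveBondHeat.EscapeGrading
open Summit.AtomisticToContinuum.FouriersLaw.Theorems.OddSectorIrreversibility

namespace Summit.AtomisticToContinuum.FouriersLaw.Theorems.BoundedResponse.HeatSpreading

open Summit.AtomisticToContinuum.FouriersLaw.Theses.BondHeatUncertainty (BoundedResponse SubdiffusiveBondHeat)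

/-! ## §T4 Trigonometric recombination and the TWISTED heat-proxy variance identity -/

/-- `cos(ωt)∫₀ᵗcos(ωs)g(t−s)ds + sin(ωt)∫₀ᵗsin(ωs)g(t−s)ds = ∫₀ᵗcos(ωs)g(s)ds` (`cos(ωt − ω(t−s)) = cos(ωs)`). [formal bookkeeping] -/
theorem cos_mul_integral_comp_sub_add {g : ℝ → ℝ} (hg : ∀ a b : ℝ, IntervalIntegrable g volume a b) (ω t : ℝ) :
    Real.cos (ω * t) * (∫ s in (0 : ℝ)..t, Real.cos (ω * s) * g (t - s)) +
        Real.sin (ω * t) * (∫ s in (0 : ℝ)..t, Real.sin (ω * s) * g (t - s)) =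
      ∫ s in (0 : ℝ)..t, Real.cos (ω * s) * g s := by
  have h1 := intervalIntegral.integral_comp_sub_left (fun x => Real.cos (ω * x) * g (t - x)) t (a := 0) (b := t)
  have h2 := intervalIntegral.integral_comp_sub_left (fun x => Real.sin (ω * x) * g (t - x)) t (a := 0) (b := t)
  simp only [sub_sub_cancel, sub_self, sub_zero] at h1 h2
  have hc1 : Continuous fun x : ℝ => Real.cos (ω * (t - x)) := by fun_prop
  have hc2 : Continuous fun x : ℝ => Real.sin (ω * (t - x)) := by fun_prop
  have i1 : IntervalIntegrable (fun x => Real.cos (ω * t) * (Real.cos (ω * (t - x)) * g x)) volume 0 t :=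
    ((hg 0 t).continuousOn_mul hc1.continuousOn).const_mul _
  have i2 : IntervalIntegrable (fun x => Real.sin (ω * t) * (Real.sin (ω * (t - x)) * g x)) volume 0 t :=
    ((hg 0 t).continuousOn_mul hc2.continuousOn).const_mul _
  rw [← h1, ← h2, ← intervalIntegral.integral_const_mul, ← intervalIntegral.integral_const_mul,
    ← intervalIntegral.integral_add i1 i2]
  refine intervalIntegral.integral_congr fun x _ => ?_
  have hc : Real.cos (ω * x) = Real.cos (ω * t - ω * (t - x)) := by congr 1; ring
  rw [hc, Real.cos_sub]
  ring

/-- `cos(ωt)∫₀ᵗsin(ωs)g(t−s)ds − sin(ωt)∫₀ᵗcos(ωs)g(t−s)ds = −∫₀ᵗsin(ωs)g(s)ds` (`sin(ωt − ω(t−s)) = sin(ωs)`). [formal bookkeeping] -/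
theorem cos_mul_integral_comp_sub_sub {g : ℝ → ℝ} (hg : ∀ a b : ℝ, IntervalIntegrable g volume a b) (ω t : ℝ) :
    Real.cos (ω * t) * (∫ s in (0 : ℝ)..t, Real.sin (ω * s) * g (t - s)) -
        Real.sin (ω * t) * (∫ s in (0 : ℝ)..t, Real.cos (ω * s) * g (t - s)) =
      -∫ s in (0 : ℝ)..t, Real.sin (ω * s) * g s := by
  have h1 := intervalIntegral.integral_comp_sub_left (fun x => Real.sin (ω * x) * g (t - x)) t (a := 0) (b := t)
  have h2 := intervalIntegral.integral_comp_sub_left (fun x => Real.cos (ω * x) * g (t - x)) t (a := 0) (b := t)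
  simp only [sub_sub_cancel, sub_self, sub_zero] at h1 h2
  have hc1 : Continuous fun x : ℝ => Real.sin (ω * (t - x)) := by fun_prop
  have hc2 : Continuous fun x : ℝ => Real.cos (ω * (t - x)) := by fun_prop
  have i1 : IntervalIntegrable (fun x => Real.cos (ω * t) * (Real.sin (ω * (t - x)) * g x)) volume 0 t :=
    ((hg 0 t).continuousOn_mul hc1.continuousOn).const_mul _
  have i2 : IntervalIntegrable (fun x => Real.sin (ω * t) * (Real.cos (ω * (t - x)) * g x)) volume 0 t :=
    ((hg 0 t).continuousOn_mul hc2.continuousOn).const_mul _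
  rw [← h1, ← h2, ← intervalIntegral.integral_const_mul, ← intervalIntegral.integral_const_mul,
    ← intervalIntegral.integral_sub i1 i2, ← intervalIntegral.integral_neg]
  refine intervalIntegral.integral_congr fun x _ => ?_
  have hs : Real.sin (ω * x) = Real.sin (ω * t - ω * (t - x)) := by congr 1; ring
  rw [hs, Real.sin_sub]
  ring

section TwistedHeatProxy

variable {ω₂ lam β γ : ℝ} (hω : 0 < ω₂) (hl : 0 < lam) (hβ : 0 < β) (hγ : 0 < γ) {N : ℕ} (hN : 1 < N)
  {T : ℝ} (hT : 0 < T)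
include hω hl hβ hγ hN hT

/-- **THE TWISTED HEAT-PROXY VARIANCE IDENTITY** (frequency-resolved Kundu–Dhar–Narayan dictionary, kernel/path level).
Let `j` be momentum-ODD, `e` and `φ` momentum-EVEN, all in `L²(μ_T)`, `L e = φ − j` (Dynkin).  Along the stationary constructed
flow, for a frequency `ω` and `t ≥ 0`, the TWISTED HEAT PROXIES
`Q^c_t := ∫₀ᵗcos(ωs)j(z_s)ds + ω∫₀ᵗsin(ωs)e(z_s)ds + cos(ωt)e(z_t) − e(z_0)`,
`Q^s_t := ∫₀ᵗsin(ωs)j(z_s)ds − ω∫₀ᵗcos(ωs)e(z_s)ds + sin(ωt)e(z_t)`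
(real and imaginary parts of `∫₀ᵗ exp(iωs)(j ds + d e)(z_s)`, integrated by parts) satisfy
`E[(Q^c_t)² + (Q^s_t)²] = 2t·⟪e, j − φ⟫_T − 2∫₀ᵗ (t − r) cos(ωr) ⟪φ, P_r φ⟫_T dr`.
At `ω = 0` this is the tree's `pinnedChain_heatProxy_sq_eq`.  Proof: expand into fifteen path moments (two-observable
weighted two-time law, its odd-lag CROSS term, weighted end-point correlations); recombine the end-point terms by
`cos(ωt − ω(t−s))`; remove every pairing with `e` on the right by the WEIGHTED integrated Dynkin identity with the weights
`(t−r)cos(ωr)`, `cos(ωr)`, `(t−r)sin(ωr)` and the parities; everything but the two displayed terms cancels. [new] -/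
theorem pinnedChain_twistedHeatProxy_sq_eq {j e φ : PhaseSpace N → ℝ} (hjm : Measurable j) (hem : Measurable e)
    (hφm : Measurable φ) (hj2 : Integrable (fun y => j y ^ 2) ((pinnedChain ω₂ lam β γ).gibbsMeasure N T))
    (he2 : Integrable (fun y => e y ^ 2) ((pinnedChain ω₂ lam β γ).gibbsMeasure N T))
    (hφ2 : Integrable (fun y => φ y ^ 2) ((pinnedChain ω₂ lam β γ).gibbsMeasure N T))
    (hjo : ∀ y : PhaseSpace N, j (y.1, -y.2) = -1 * j y) (hee : ∀ y : PhaseSpace N, e (y.1, -y.2) = 1 * e y)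
    (hφe : ∀ y : PhaseSpace N, φ (y.1, -y.2) = 1 * φ y)
    (hdyn : ∀ (r : ℝ≥0) (z : PhaseSpace N),
      ∫ y, e y ∂((pinnedChain ω₂ lam β γ).transitionKernel N T T r z) - e z =
        ∫ s in (0 : ℝ)..(r : ℝ), ∫ y, (φ y - j y) ∂((pinnedChain ω₂ lam β γ).transitionKernel N T T s.toNNReal z))
    (ω : ℝ) {t : ℝ} (ht : 0 ≤ t) :
    ∫ p, (((∫ s in (0 : ℝ)..t, Real.cos (ω * s) * j ((pinnedChain ω₂ lam β γ).solMap N T T s p.1 (pairPath p.2))) + ω * (∫ s in (0 : ℝ)..t, Real.sin (ω * s) * e ((pinnedChain ω₂ lam β γ).solMap N T T s p.1 (pairPath p.2))) +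
            (Real.cos (ω * t) * e ((pinnedChain ω₂ lam β γ).solMap N T T t p.1 (pairPath p.2)) - e p.1)) ^ 2 +
          ((∫ s in (0 : ℝ)..t, Real.sin (ω * s) * j ((pinnedChain ω₂ lam β γ).solMap N T T s p.1 (pairPath p.2))) - ω * (∫ s in (0 : ℝ)..t, Real.cos (ω * s) * e ((pinnedChain ω₂ lam β γ).solMap N T T s p.1 (pairPath p.2))) +
            Real.sin (ω * t) * e ((pinnedChain ω₂ lam β γ).solMap N T T t p.1 (pairPath p.2))) ^ 2) ∂(((pinnedChain ω₂ lam β γ).gibbsMeasure N T).prod wienerPair) =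
      2 * t * spair ω₂ lam β γ T N e (fun y => j y - φ y) -
        2 * ∫ r in (0 : ℝ)..t, (t - r) * (Real.cos (ω * r) * kpair ω₂ lam β γ T N φ φ r) := by
  have hN0 : 0 < N := Nat.zero_lt_of_lt hN
  haveI := pinnedChain_isProbabilityMeasure_gibbsMeasure hω hl.le hβ.le γ N hT
  have hinv := pinnedChain_hinv_T hω hl hβ hγ hN hT
  -- the drift `ℓ = φ − j ∈ L²`
  have hℓm : Measurable (fun y => φ y - j y) := hφm.sub hjm
  have hℓ2 : Integrable (fun y => (φ y - j y) ^ 2) ((pinnedChain ω₂ lam β γ).gibbsMeasure N T) := by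
    refine ((hφ2.add hj2).const_mul 2).mono' (hℓm.pow_const 2).aestronglyMeasurable (Eventually.of_forall fun y => ?_)
    rw [Real.norm_eq_abs, abs_of_nonneg (sq_nonneg _)]
    simp only [Pi.add_apply]
    nlinarith [sq_nonneg (φ y + j y)]
  have h0 : ∀ (y : PhaseSpace N) (w' : WienerPair), (pinnedChain ω₂ lam β γ).solMap N T T 0 y w' = y :=
    fun y w' => pinnedChain_solMap_of_nonpos N T T y w' le_rfl
  -- weights
  have hcm : Measurable fun s : ℝ => Real.cos (ω * s) := by fun_prop
  have hsm : Measurable fun s : ℝ => Real.sin (ω * s) := by fun_prop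
  have hcb : ∀ s : ℝ, |Real.cos (ω * s)| ≤ 1 := fun s => Real.abs_cos_le_one _
  have hsb : ∀ s : ℝ, |Real.sin (ω * s)| ≤ 1 := fun s => Real.abs_sin_le_one _
  -- parity of the cross pairing
  have hpar : ∀ r, kpair ω₂ lam β γ T N e j r = -kpair ω₂ lam β γ T N j e r := by
    intro r
    rw [kpair_parity hω hl hβ hγ hN hT hem hjm he2 hj2 hee hjo r]
    ring
  -- (1) `E[A²] + E[B²]`, `E[D²] + E[C²]` (cos² + sin² moments)
  have mAB : (∫ p, (∫ s in (0 : ℝ)..t, Real.cos (ω * s) * j ((pinnedChain ω₂ lam β γ).solMap N T T s p.1 (pairPath p.2))) ^ 2 ∂(((pinnedChain ω₂ lam β γ).gibbsMeasure N T).prod wienerPair)) +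
      (∫ p, (∫ s in (0 : ℝ)..t, Real.sin (ω * s) * j ((pinnedChain ω₂ lam β γ).solMap N T T s p.1 (pairPath p.2))) ^ 2 ∂(((pinnedChain ω₂ lam β γ).gibbsMeasure N T).prod wienerPair)) =
      2 * ∫ r in (0 : ℝ)..t, (t - r) * (Real.cos (ω * r) * kpair ω₂ lam β γ T N j j r) := by
    have h := pinnedChain_integral_cos_sq_add_sin_sq_of_invariant hω hl.le hβ.le hγ.le N T T _ hinv hjm hj2
      (pinnedChain_measurable_kernelPairing hω hl.le hβ.le hγ.le N T T _ hjm hjm) ω ht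
    unfold kpair
    exact h
  have mCD : (∫ p, (∫ s in (0 : ℝ)..t, Real.cos (ω * s) * e ((pinnedChain ω₂ lam β γ).solMap N T T s p.1 (pairPath p.2))) ^ 2 ∂(((pinnedChain ω₂ lam β γ).gibbsMeasure N T).prod wienerPair)) +
      (∫ p, (∫ s in (0 : ℝ)..t, Real.sin (ω * s) * e ((pinnedChain ω₂ lam β γ).solMap N T T s p.1 (pairPath p.2))) ^ 2 ∂(((pinnedChain ω₂ lam β γ).gibbsMeasure N T).prod wienerPair)) =
      2 * ∫ r in (0 : ℝ)..t, (t - r) * (Real.cos (ω * r) * kpair ω₂ lam β γ T N e e r) := by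
    have h := pinnedChain_integral_cos_sq_add_sin_sq_of_invariant hω hl.le hβ.le hγ.le N T T _ hinv hem he2
      (pinnedChain_measurable_kernelPairing hω hl.le hβ.le hγ.le N T T _ hem hem) ω ht
    unfold kpair
    exact h
  -- (2) the cross moment `E[AC] − E[BD]`
  have mX : (∫ p, (∫ s in (0 : ℝ)..t, Real.cos (ω * s) * j ((pinnedChain ω₂ lam β γ).solMap N T T s p.1 (pairPath p.2))) * (∫ s in (0 : ℝ)..t, Real.sin (ω * s) * e ((pinnedChain ω₂ lam β γ).solMap N T T s p.1 (pairPath p.2))) ∂(((pinnedChain ω₂ lam β γ).gibbsMeasure N T).prod wienerPair)) -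
      (∫ p, (∫ s in (0 : ℝ)..t, Real.sin (ω * s) * j ((pinnedChain ω₂ lam β γ).solMap N T T s p.1 (pairPath p.2))) * (∫ s in (0 : ℝ)..t, Real.cos (ω * s) * e ((pinnedChain ω₂ lam β γ).solMap N T T s p.1 (pairPath p.2))) ∂(((pinnedChain ω₂ lam β γ).gibbsMeasure N T).prod wienerPair)) =
      2 * ∫ r in (0 : ℝ)..t, (t - r) * (Real.sin (ω * r) * kpair ω₂ lam β γ T N j e r) :=
    pinnedChain_integral_cos_sin_cross_eq hω hl hβ hγ hN hT hjm hem hj2 he2 hpar ω ht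
  -- (3) end-point moments
  have mEA : ∫ p, e ((pinnedChain ω₂ lam β γ).solMap N T T t p.1 (pairPath p.2)) * (∫ s in (0 : ℝ)..t, Real.cos (ω * s) * j ((pinnedChain ω₂ lam β γ).solMap N T T s p.1 (pairPath p.2))) ∂(((pinnedChain ω₂ lam β γ).gibbsMeasure N T).prod wienerPair) = ∫ s in (0 : ℝ)..t, Real.cos (ω * s) * kpair ω₂ lam β γ T N j e (t - s) :=
    pinnedChain_integral_final_mul_weightedIntegral_eq hω hl hβ hγ hN hT hjm hem hj2 he2 hcm hcb ht
  have mEB : ∫ p, e ((pinnedChain ω₂ lam β γ).solMap N T T t p.1 (pairPath p.2)) * (∫ s in (0 : ℝ)..t, Real.sin (ω * s) * j ((pinnedChain ω₂ lam β γ).solMap N T T s p.1 (pairPath p.2))) ∂(((pinnedChain ω₂ lam β γ).gibbsMeasure N T).prod wienerPair) = ∫ s in (0 : ℝ)..t, Real.sin (ω * s) * kpair ω₂ lam β γ T N j e (t - s) :=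
    pinnedChain_integral_final_mul_weightedIntegral_eq hω hl hβ hγ hN hT hjm hem hj2 he2 hsm hsb ht
  have mEC : ∫ p, e ((pinnedChain ω₂ lam β γ).solMap N T T t p.1 (pairPath p.2)) * (∫ s in (0 : ℝ)..t, Real.sin (ω * s) * e ((pinnedChain ω₂ lam β γ).solMap N T T s p.1 (pairPath p.2))) ∂(((pinnedChain ω₂ lam β γ).gibbsMeasure N T).prod wienerPair) = ∫ s in (0 : ℝ)..t, Real.sin (ω * s) * kpair ω₂ lam β γ T N e e (t - s) :=
    pinnedChain_integral_final_mul_weightedIntegral_eq hω hl hβ hγ hN hT hem hem he2 he2 hsm hsb ht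
  have mED : ∫ p, e ((pinnedChain ω₂ lam β γ).solMap N T T t p.1 (pairPath p.2)) * (∫ s in (0 : ℝ)..t, Real.cos (ω * s) * e ((pinnedChain ω₂ lam β γ).solMap N T T s p.1 (pairPath p.2))) ∂(((pinnedChain ω₂ lam β γ).gibbsMeasure N T).prod wienerPair) = ∫ s in (0 : ℝ)..t, Real.cos (ω * s) * kpair ω₂ lam β γ T N e e (t - s) :=
    pinnedChain_integral_final_mul_weightedIntegral_eq hω hl hβ hγ hN hT hem hem he2 he2 hcm hcb ht
  have mE0A : ∫ p, e p.1 * (∫ s in (0 : ℝ)..t, Real.cos (ω * s) * j ((pinnedChain ω₂ lam β γ).solMap N T T s p.1 (pairPath p.2))) ∂(((pinnedChain ω₂ lam β γ).gibbsMeasure N T).prod wienerPair) = ∫ s in (0 : ℝ)..t, Real.cos (ω * s) * kpair ω₂ lam β γ T N e j s :=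
    pinnedChain_integral_initial_mul_weightedIntegral_eq hω hl hβ hγ hN hT hjm hem hj2 he2 hcm hcb ht
  have mE0C : ∫ p, e p.1 * (∫ s in (0 : ℝ)..t, Real.sin (ω * s) * e ((pinnedChain ω₂ lam β γ).solMap N T T s p.1 (pairPath p.2))) ∂(((pinnedChain ω₂ lam β γ).gibbsMeasure N T).prod wienerPair) = ∫ s in (0 : ℝ)..t, Real.sin (ω * s) * kpair ω₂ lam β γ T N e e s :=
    pinnedChain_integral_initial_mul_weightedIntegral_eq hω hl hβ hγ hN hT hem hem he2 he2 hsm hsb ht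
  have met := pinnedChain_integrable_sq_solMap_of_invariant hω hl.le hβ.le hγ.le N T T _ hinv he2 t
  have me0 := pinnedChain_integrable_sq_solMap_of_invariant hω hl.le hβ.le hγ.le N T T _ hinv he2 0
  simp only [h0] at me0
  have me0et : ∫ p, e p.1 * e ((pinnedChain ω₂ lam β γ).solMap N T T t p.1 (pairPath p.2)) ∂(((pinnedChain ω₂ lam β γ).gibbsMeasure N T).prod wienerPair) = kpair ω₂ lam β γ T N e e t := by
    have h := pinnedChain_pathCorr_eq_of_nonneg hω hl.le hβ.le hγ.le N T T _ hinv hem hem he2 he2 ht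
    simp only [h0] at h
    exact h
  -- (4) integrability of the fifteen moments
  have iAA : Integrable (fun p : PhaseSpace N × WienerPair => (∫ s in (0 : ℝ)..t, Real.cos (ω * s) * j ((pinnedChain ω₂ lam β γ).solMap N T T s p.1 (pairPath p.2))) ^ 2) (((pinnedChain ω₂ lam β γ).gibbsMeasure N T).prod wienerPair) := by
    simpa only [sq] using pinnedChain_integrable_weightedIntegral_mul hω hl hβ hγ hN hT hjm hjm hj2 hj2 hcm hcm hcb hcb ht
  have iBB : Integrable (fun p : PhaseSpace N × WienerPair => (∫ s in (0 : ℝ)..t, Real.sin (ω * s) * j ((pinnedChain ω₂ lam β γ).solMap N T T s p.1 (pairPath p.2))) ^ 2) (((pinnedChain ω₂ lam β γ).gibbsMeasure N T).prod wienerPair) := by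
    simpa only [sq] using pinnedChain_integrable_weightedIntegral_mul hω hl hβ hγ hN hT hjm hjm hj2 hj2 hsm hsm hsb hsb ht
  have iCC : Integrable (fun p : PhaseSpace N × WienerPair => (∫ s in (0 : ℝ)..t, Real.sin (ω * s) * e ((pinnedChain ω₂ lam β γ).solMap N T T s p.1 (pairPath p.2))) ^ 2) (((pinnedChain ω₂ lam β γ).gibbsMeasure N T).prod wienerPair) := by
    simpa only [sq] using pinnedChain_integrable_weightedIntegral_mul hω hl hβ hγ hN hT hem hem he2 he2 hsm hsm hsb hsb ht
  have iDD : Integrable (fun p : PhaseSpace N × WienerPair => (∫ s in (0 : ℝ)..t, Real.cos (ω * s) * e ((pinnedChain ω₂ lam β γ).solMap N T T s p.1 (pairPath p.2))) ^ 2) (((pinnedChain ω₂ lam β γ).gibbsMeasure N T).prod wienerPair) := by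
    simpa only [sq] using pinnedChain_integrable_weightedIntegral_mul hω hl hβ hγ hN hT hem hem he2 he2 hcm hcm hcb hcb ht
  have iAC := pinnedChain_integrable_weightedIntegral_mul hω hl hβ hγ hN hT hjm hem hj2 he2 hcm hsm hcb hsb ht
  have iBD := pinnedChain_integrable_weightedIntegral_mul hω hl hβ hγ hN hT hjm hem hj2 he2 hsm hcm hsb hcb ht
  have iEA := pinnedChain_integrable_mul_weightedIntegral hω hl hβ hγ hN hT hjm hem hj2 he2 hcm hcb t ht
  have iEB := pinnedChain_integrable_mul_weightedIntegral hω hl hβ hγ hN hT hjm hem hj2 he2 hsm hsb t ht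
  have iEC := pinnedChain_integrable_mul_weightedIntegral hω hl hβ hγ hN hT hem hem he2 he2 hsm hsb t ht
  have iED := pinnedChain_integrable_mul_weightedIntegral hω hl hβ hγ hN hT hem hem he2 he2 hcm hcb t ht
  have iE0A := pinnedChain_integrable_mul_weightedIntegral hω hl hβ hγ hN hT hjm hem hj2 he2 hcm hcb 0 ht
  have iE0C := pinnedChain_integrable_mul_weightedIntegral hω hl hβ hγ hN hT hem hem he2 he2 hsm hsb 0 ht
  simp only [h0] at iE0A iE0C
  have ie0et : Integrable (fun p : PhaseSpace N × WienerPair => e p.1 * e ((pinnedChain ω₂ lam β γ).solMap N T T t p.1 (pairPath p.2))) (((pinnedChain ω₂ lam β γ).gibbsMeasure N T).prod wienerPair) := by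
    refine (me0.1.add met.1).mono' ((hem.comp measurable_fst).mul
      (hem.comp (pinnedChain_measurable_solMap_pairPath hω hl.le hβ.le hγ.le N T T t))).aestronglyMeasurable
      (Eventually.of_forall fun p => ?_)
    simpa [Real.norm_eq_abs] using abs_mul_le_sq_add_sq _ _
  -- (5) expand the square and substitute the moments
  have hexp := integral_twist_sq_expand (ν := (((pinnedChain ω₂ lam β γ).gibbsMeasure N T).prod wienerPair))
    (A := fun p => (∫ s in (0 : ℝ)..t, Real.cos (ω * s) * j ((pinnedChain ω₂ lam β γ).solMap N T T s p.1 (pairPath p.2)))) (B := fun p => (∫ s in (0 : ℝ)..t, Real.sin (ω * s) * j ((pinnedChain ω₂ lam β γ).solMap N T T s p.1 (pairPath p.2))))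
    (C := fun p => (∫ s in (0 : ℝ)..t, Real.sin (ω * s) * e ((pinnedChain ω₂ lam β γ).solMap N T T s p.1 (pairPath p.2)))) (D := fun p => (∫ s in (0 : ℝ)..t, Real.cos (ω * s) * e ((pinnedChain ω₂ lam β γ).solMap N T T s p.1 (pairPath p.2))))
    (E := fun p => e ((pinnedChain ω₂ lam β γ).solMap N T T t p.1 (pairPath p.2))) (E₀ := fun p => e p.1) ω (Real.cos (ω * t)) (Real.sin (ω * t))
    iAA iBB iCC iDD iAC iBD iEA iEC iE0A iE0C iEB iED met.1 ie0et me0.1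
  beta_reduce at hexp
  rw [hexp, mAB, mCD, mX, mEA, mEB, mEC, mED, mE0A, mE0C, met.2, me0et, me0.2]
  -- (6) kernel-level bookkeeping: trigonometric recombination of the end-point terms
  have iJE : ∀ a b : ℝ, IntervalIntegrable (kpair ω₂ lam β γ T N j e) volume a b := intervalIntegrable_kpair hω hl hβ hγ hN hT hjm hem hj2 he2
  have iEE : ∀ a b : ℝ, IntervalIntegrable (kpair ω₂ lam β γ T N e e) volume a b := intervalIntegrable_kpair hω hl hβ hγ hN hT hem hem he2 he2
  have X1 := cos_mul_integral_comp_sub_add iJE ω t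
  have X2 := cos_mul_integral_comp_sub_sub iEE ω t
  have P0 : (∫ s in (0 : ℝ)..t, Real.cos (ω * s) * kpair ω₂ lam β γ T N e j s) = -∫ r in (0 : ℝ)..t, Real.cos (ω * r) * kpair ω₂ lam β γ T N j e r := by
    rw [← intervalIntegral.integral_neg]
    exact intervalIntegral.integral_congr fun s _ => by rw [hpar s]; ring
  -- (7) the weighted Dynkin identities
  have sJ : ∀ r, kpair ω₂ lam β γ T N j (fun y => φ y - j y) r = kpair ω₂ lam β γ T N j φ r - kpair ω₂ lam β γ T N j j r :=
    fun r => kpair_sub_right hω hl hβ hγ hN hT hjm hφm hjm hj2 hφ2 hj2 r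
  have sE : ∀ r, kpair ω₂ lam β γ T N e (fun y => φ y - j y) r = kpair ω₂ lam β γ T N φ e r + kpair ω₂ lam β γ T N j e r := by
    intro r
    rw [kpair_sub_right hω hl hβ hγ hN hT hem hφm hjm he2 hφ2 hj2 r, kpair_parity hω hl hβ hγ hN hT hem hφm he2 hφ2 hee hφe r,
      kpair_parity hω hl hβ hγ hN hT hem hjm he2 hj2 hee hjo r]
    ring
  have sΦ : ∀ r, kpair ω₂ lam β γ T N φ (fun y => φ y - j y) r = kpair ω₂ lam β γ T N φ φ r + kpair ω₂ lam β γ T N j φ r := by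
    intro r
    rw [kpair_sub_right hω hl hβ hγ hN hT hφm hφm hjm hφ2 hφ2 hj2 r, kpair_parity hω hl hβ hγ hN hT hφm hjm hφ2 hj2 hφe hjo r]
    ring
  -- continuity of the weights and interval integrability of the weighted pairings
  have ccos : Continuous fun r : ℝ => Real.cos (ω * r) := by fun_prop
  have csin : Continuous fun r : ℝ => Real.sin (ω * r) := by fun_prop
  have clin : Continuous fun r : ℝ => t - r := by fun_prop
  have wI : ∀ {g : ℝ → ℝ} {w : ℝ → ℝ}, Continuous w → IntervalIntegrable g volume 0 t →
      IntervalIntegrable (fun r => w r * g r) volume 0 t := fun hw hg => hg.continuousOn_mul hw.continuousOn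
  have hIcc : IntervalIntegrable (fun r => Real.cos (ω * r) * kpair ω₂ lam β γ T N j e r) volume 0 t := wI ccos (iJE 0 t)
  have hIsc : IntervalIntegrable (fun r => (t - r) * (Real.sin (ω * r) * kpair ω₂ lam β γ T N j e r)) volume 0 t := wI clin (wI csin (iJE 0 t))
  have hIca : IntervalIntegrable (fun r => (t - r) * (Real.cos (ω * r) * kpair ω₂ lam β γ T N j j r)) volume 0 t :=
    wI clin (wI ccos (intervalIntegrable_kpair hω hl hβ hγ hN hT hjm hjm hj2 hj2 0 t))
  have hIcm : IntervalIntegrable (fun r => (t - r) * (Real.cos (ω * r) * kpair ω₂ lam β γ T N j φ r)) volume 0 t :=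
    wI clin (wI ccos (intervalIntegrable_kpair hω hl hβ hγ hN hT hjm hφm hj2 hφ2 0 t))
  have hIcd : IntervalIntegrable (fun r => (t - r) * (Real.cos (ω * r) * kpair ω₂ lam β γ T N φ φ r)) volume 0 t :=
    wI clin (wI ccos (intervalIntegrable_kpair hω hl hβ hγ hN hT hφm hφm hφ2 hφ2 0 t))
  have hIcb : IntervalIntegrable (fun r => (t - r) * (Real.cos (ω * r) * kpair ω₂ lam β γ T N e e r)) volume 0 t := wI clin (wI ccos (iEE 0 t))
  have hIsn : IntervalIntegrable (fun r => (t - r) * (Real.sin (ω * r) * kpair ω₂ lam β γ T N φ e r)) volume 0 t :=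
    wI clin (wI csin (intervalIntegrable_kpair hω hl hβ hγ hN hT hφm hem hφ2 he2 0 t))
  have hJcn : IntervalIntegrable (fun r => Real.cos (ω * r) * kpair ω₂ lam β γ T N φ e r) volume 0 t :=
    wI ccos (intervalIntegrable_kpair hω hl hβ hγ hN hT hφm hem hφ2 he2 0 t)
  have hJsb : IntervalIntegrable (fun r => Real.sin (ω * r) * kpair ω₂ lam β γ T N e e r) volume 0 t := wI csin (iEE 0 t)
  have hPnc : IntervalIntegrable (kpair ω₂ lam β γ T N e (fun y => φ y - j y)) volume 0 t := intervalIntegrable_kpair hω hl hβ hγ hN hT hem hℓm he2 hℓ2 0 t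
  -- derivative data of the three weights
  have hw1 : ∀ r, HasDerivAt (fun r => (t - r) * Real.cos (ω * r)) (-Real.cos (ω * r) - ω * ((t - r) * Real.sin (ω * r))) r :=
    fun r => (((hasDerivAt_id' r).const_sub t).mul (((hasDerivAt_id' r).const_mul ω).cos)).congr_deriv (by ring)
  have hw1' : Continuous fun r => -Real.cos (ω * r) - ω * ((t - r) * Real.sin (ω * r)) := by fun_prop
  have hw3 : ∀ r, HasDerivAt (fun r => Real.cos (ω * r)) (-(ω * Real.sin (ω * r))) r :=
    fun r => (((hasDerivAt_id' r).const_mul ω).cos).congr_deriv (by ring)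
  have hw3' : Continuous fun r => -(ω * Real.sin (ω * r)) := by fun_prop
  have hw4 : ∀ r, HasDerivAt (fun r => (t - r) * Real.sin (ω * r)) (-Real.sin (ω * r) + ω * ((t - r) * Real.cos (ω * r))) r :=
    fun r => (((hasDerivAt_id' r).const_sub t).mul (((hasDerivAt_id' r).const_mul ω).sin)).congr_deriv (by ring)
  have hw4' : Continuous fun r => -Real.sin (ω * r) + ω * ((t - r) * Real.cos (ω * r)) := by fun_prop
  -- (K1) weight `(t−r)cos(ωr)`, `f = j`
  have h1 := integral_deriv_mul_kpair_eq_of_dynkin hω hl hβ hγ hN hT hjm hem hℓm hj2 he2 hℓ2 hdyn hw1 hw1' ht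
  have hL1 : (∫ r in (0 : ℝ)..t, (-Real.cos (ω * r) - ω * ((t - r) * Real.sin (ω * r))) * kpair ω₂ lam β γ T N j e r) =
      -(∫ r in (0 : ℝ)..t, Real.cos (ω * r) * kpair ω₂ lam β γ T N j e r) - ω * (∫ r in (0 : ℝ)..t, (t - r) * (Real.sin (ω * r) * kpair ω₂ lam β γ T N j e r)) := by
    have i1 : IntervalIntegrable (fun r => -(Real.cos (ω * r) * kpair ω₂ lam β γ T N j e r)) volume 0 t := hIcc.neg
    have i2 : IntervalIntegrable (fun r => ω * ((t - r) * (Real.sin (ω * r) * kpair ω₂ lam β γ T N j e r))) volume 0 t := hIsc.const_mul ω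
    rw [← intervalIntegral.integral_neg, ← intervalIntegral.integral_const_mul, ← intervalIntegral.integral_sub i1 i2]
    exact intervalIntegral.integral_congr fun r _ => by ring
  have hR1a : ((t - t) * Real.cos (ω * t) - (t - 0) * Real.cos (ω * 0)) * spair ω₂ lam β γ T N j e = -t * spair ω₂ lam β γ T N j e := by simp
  have hR1b : (∫ u in (0 : ℝ)..t, ((t - t) * Real.cos (ω * t) - (t - u) * Real.cos (ω * u)) * kpair ω₂ lam β γ T N j (fun y => φ y - j y) u) =
      -(∫ r in (0 : ℝ)..t, (t - r) * (Real.cos (ω * r) * kpair ω₂ lam β γ T N j φ r)) + ∫ r in (0 : ℝ)..t, (t - r) * (Real.cos (ω * r) * kpair ω₂ lam β γ T N j j r) := by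
    have i1 : IntervalIntegrable (fun r => -((t - r) * (Real.cos (ω * r) * kpair ω₂ lam β γ T N j φ r))) volume 0 t := hIcm.neg
    rw [← intervalIntegral.integral_neg, ← intervalIntegral.integral_add i1 hIca]
    refine intervalIntegral.integral_congr fun r _ => ?_
    simp only [sJ r]
    ring
  have K1 : -(∫ r in (0 : ℝ)..t, Real.cos (ω * r) * kpair ω₂ lam β γ T N j e r) - ω * (∫ r in (0 : ℝ)..t, (t - r) * (Real.sin (ω * r) * kpair ω₂ lam β γ T N j e r)) =
      -t * spair ω₂ lam β γ T N j e - (∫ r in (0 : ℝ)..t, (t - r) * (Real.cos (ω * r) * kpair ω₂ lam β γ T N j φ r)) + ∫ r in (0 : ℝ)..t, (t - r) * (Real.cos (ω * r) * kpair ω₂ lam β γ T N j j r) := by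
    linear_combination h1 - hL1 + hR1a + hR1b
  -- (K2) weight `(t−r)cos(ωr)`, `f = φ`
  have h2 := integral_deriv_mul_kpair_eq_of_dynkin hω hl hβ hγ hN hT hφm hem hℓm hφ2 he2 hℓ2 hdyn hw1 hw1' ht
  have hL2 : (∫ r in (0 : ℝ)..t, (-Real.cos (ω * r) - ω * ((t - r) * Real.sin (ω * r))) * kpair ω₂ lam β γ T N φ e r) =
      -(∫ r in (0 : ℝ)..t, Real.cos (ω * r) * kpair ω₂ lam β γ T N φ e r) - ω * (∫ r in (0 : ℝ)..t, (t - r) * (Real.sin (ω * r) * kpair ω₂ lam β γ T N φ e r)) := by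
    have i1 : IntervalIntegrable (fun r => -(Real.cos (ω * r) * kpair ω₂ lam β γ T N φ e r)) volume 0 t := hJcn.neg
    have i2 : IntervalIntegrable (fun r => ω * ((t - r) * (Real.sin (ω * r) * kpair ω₂ lam β γ T N φ e r))) volume 0 t := hIsn.const_mul ω
    rw [← intervalIntegral.integral_neg, ← intervalIntegral.integral_const_mul, ← intervalIntegral.integral_sub i1 i2]
    exact intervalIntegral.integral_congr fun r _ => by ring
  have hR2a : ((t - t) * Real.cos (ω * t) - (t - 0) * Real.cos (ω * 0)) * spair ω₂ lam β γ T N φ e = -t * spair ω₂ lam β γ T N φ e := by simp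
  have hR2b : (∫ u in (0 : ℝ)..t, ((t - t) * Real.cos (ω * t) - (t - u) * Real.cos (ω * u)) * kpair ω₂ lam β γ T N φ (fun y => φ y - j y) u) =
      -(∫ r in (0 : ℝ)..t, (t - r) * (Real.cos (ω * r) * kpair ω₂ lam β γ T N φ φ r)) - ∫ r in (0 : ℝ)..t, (t - r) * (Real.cos (ω * r) * kpair ω₂ lam β γ T N j φ r) := by
    have i1 : IntervalIntegrable (fun r => -((t - r) * (Real.cos (ω * r) * kpair ω₂ lam β γ T N φ φ r))) volume 0 t := hIcd.neg
    rw [← intervalIntegral.integral_neg, ← intervalIntegral.integral_sub i1 hIcm]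
    refine intervalIntegral.integral_congr fun r _ => ?_
    simp only [sΦ r]
    ring
  have K2 : -(∫ r in (0 : ℝ)..t, Real.cos (ω * r) * kpair ω₂ lam β γ T N φ e r) - ω * (∫ r in (0 : ℝ)..t, (t - r) * (Real.sin (ω * r) * kpair ω₂ lam β γ T N φ e r)) =
      -t * spair ω₂ lam β γ T N φ e - (∫ r in (0 : ℝ)..t, (t - r) * (Real.cos (ω * r) * kpair ω₂ lam β γ T N φ φ r)) - ∫ r in (0 : ℝ)..t, (t - r) * (Real.cos (ω * r) * kpair ω₂ lam β γ T N j φ r) := by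
    linear_combination h2 - hL2 + hR2a + hR2b
  -- (K3) weight `cos(ωr)`, `f = e`
  have h3 := integral_deriv_mul_kpair_eq_of_dynkin hω hl hβ hγ hN hT hem hem hℓm he2 he2 hℓ2 hdyn hw3 hw3' ht
  have hL3 : (∫ r in (0 : ℝ)..t, (-(ω * Real.sin (ω * r))) * kpair ω₂ lam β γ T N e e r) = -(ω * (∫ r in (0 : ℝ)..t, Real.sin (ω * r) * kpair ω₂ lam β γ T N e e r)) := by
    rw [← intervalIntegral.integral_const_mul, ← intervalIntegral.integral_neg]
    exact intervalIntegral.integral_congr fun r _ => by ring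
  have hR3a : (Real.cos (ω * t) - Real.cos (ω * 0)) * spair ω₂ lam β γ T N e e = (Real.cos (ω * t) - 1) * spair ω₂ lam β γ T N e e := by
    rw [mul_zero, Real.cos_zero]
  have hR3b : (∫ u in (0 : ℝ)..t, (Real.cos (ω * t) - Real.cos (ω * u)) * kpair ω₂ lam β γ T N e (fun y => φ y - j y) u) =
      Real.cos (ω * t) * (∫ u in (0 : ℝ)..t, kpair ω₂ lam β γ T N e (fun y => φ y - j y) u) - (∫ r in (0 : ℝ)..t, Real.cos (ω * r) * kpair ω₂ lam β γ T N φ e r) - ∫ r in (0 : ℝ)..t, Real.cos (ω * r) * kpair ω₂ lam β γ T N j e r := by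
    have i1 : IntervalIntegrable (fun u => Real.cos (ω * t) * kpair ω₂ lam β γ T N e (fun y => φ y - j y) u) volume 0 t := hPnc.const_mul _
    have i2 : IntervalIntegrable (fun u => Real.cos (ω * t) * kpair ω₂ lam β γ T N e (fun y => φ y - j y) u - Real.cos (ω * u) * kpair ω₂ lam β γ T N φ e u) volume 0 t :=
      i1.sub hJcn
    rw [← intervalIntegral.integral_const_mul, ← intervalIntegral.integral_sub i1 hJcn, ← intervalIntegral.integral_sub i2 hIcc]
    refine intervalIntegral.integral_congr fun r _ => ?_
    simp only [sE r]
    ring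
  have K3 : -(ω * (∫ r in (0 : ℝ)..t, Real.sin (ω * r) * kpair ω₂ lam β γ T N e e r)) =
      (Real.cos (ω * t) - 1) * spair ω₂ lam β γ T N e e + Real.cos (ω * t) * (∫ u in (0 : ℝ)..t, kpair ω₂ lam β γ T N e (fun y => φ y - j y) u) - (∫ r in (0 : ℝ)..t, Real.cos (ω * r) * kpair ω₂ lam β γ T N φ e r) - ∫ r in (0 : ℝ)..t, Real.cos (ω * r) * kpair ω₂ lam β γ T N j e r := by
    linear_combination h3 - hL3 + hR3a + hR3b
  -- (K4) weight `(t−r)sin(ωr)`, `f = e`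
  have h4 := integral_deriv_mul_kpair_eq_of_dynkin hω hl hβ hγ hN hT hem hem hℓm he2 he2 hℓ2 hdyn hw4 hw4' ht
  have hL4 : (∫ r in (0 : ℝ)..t, (-Real.sin (ω * r) + ω * ((t - r) * Real.cos (ω * r))) * kpair ω₂ lam β γ T N e e r) =
      -(∫ r in (0 : ℝ)..t, Real.sin (ω * r) * kpair ω₂ lam β γ T N e e r) + ω * (∫ r in (0 : ℝ)..t, (t - r) * (Real.cos (ω * r) * kpair ω₂ lam β γ T N e e r)) := by
    have i1 : IntervalIntegrable (fun r => -(Real.sin (ω * r) * kpair ω₂ lam β γ T N e e r)) volume 0 t := hJsb.neg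
    have i2 : IntervalIntegrable (fun r => ω * ((t - r) * (Real.cos (ω * r) * kpair ω₂ lam β γ T N e e r))) volume 0 t := hIcb.const_mul ω
    rw [← intervalIntegral.integral_neg, ← intervalIntegral.integral_const_mul, ← intervalIntegral.integral_add i1 i2]
    exact intervalIntegral.integral_congr fun r _ => by ring
  have hR4a : ((t - t) * Real.sin (ω * t) - (t - 0) * Real.sin (ω * 0)) * spair ω₂ lam β γ T N e e = 0 := by simp
  have hR4b : (∫ u in (0 : ℝ)..t, ((t - t) * Real.sin (ω * t) - (t - u) * Real.sin (ω * u)) * kpair ω₂ lam β γ T N e (fun y => φ y - j y) u) =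
      -(∫ r in (0 : ℝ)..t, (t - r) * (Real.sin (ω * r) * kpair ω₂ lam β γ T N φ e r)) - ∫ r in (0 : ℝ)..t, (t - r) * (Real.sin (ω * r) * kpair ω₂ lam β γ T N j e r) := by
    have i1 : IntervalIntegrable (fun r => -((t - r) * (Real.sin (ω * r) * kpair ω₂ lam β γ T N φ e r))) volume 0 t := hIsn.neg
    rw [← intervalIntegral.integral_neg, ← intervalIntegral.integral_sub i1 hIsc]
    refine intervalIntegral.integral_congr fun r _ => ?_
    simp only [sE r]
    ring
  have K4 : -(∫ r in (0 : ℝ)..t, Real.sin (ω * r) * kpair ω₂ lam β γ T N e e r) + ω * (∫ r in (0 : ℝ)..t, (t - r) * (Real.cos (ω * r) * kpair ω₂ lam β γ T N e e r)) = -(∫ r in (0 : ℝ)..t, (t - r) * (Real.sin (ω * r) * kpair ω₂ lam β γ T N φ e r)) - ∫ r in (0 : ℝ)..t, (t - r) * (Real.sin (ω * r) * kpair ω₂ lam β γ T N j e r) := by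
    linear_combination h4 - hL4 + hR4a + hR4b
  -- (K5) `⟪e,P_t e⟫ − ‖e‖² = ∫₀ᵗ ⟪e, P ℓ⟫`
  have K5 := kpair_dynkin hω hl hβ hγ hN hT hem hem hℓm he2 he2 hℓ2 hdyn ht
  -- static pairings and `cos² + sin² = 1`
  have sEE : spair ω₂ lam β γ T N e e = ∫ y, e y ^ 2 ∂((pinnedChain ω₂ lam β γ).gibbsMeasure N T) := by
    simp only [spair, sq]
  have sEJΦ : spair ω₂ lam β γ T N e (fun y => j y - φ y) = spair ω₂ lam β γ T N j e - spair ω₂ lam β γ T N φ e := by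
    simp only [spair]
    rw [← integral_sub (integrable_mul_of_sq N hjm hem hj2 he2) (integrable_mul_of_sq N hφm hem hφ2 he2)]
    refine integral_congr_ae (Eventually.of_forall fun y => ?_)
    ring
  have hcs : Real.cos (ω * t) ^ 2 + Real.sin (ω * t) ^ 2 = 1 := Real.cos_sq_add_sin_sq _
  linear_combination 2 * X1 + (2 * ω) * X2 - 2 * P0 - 2 * K1 + 2 * K2 + 2 * K3 + (2 * ω) * K4 -
    (2 * Real.cos (ω * t)) * K5 + (∫ y, e y ^ 2 ∂((pinnedChain ω₂ lam β γ).gibbsMeasure N T)) * hcs - 2 * sEE - (2 * t) * sEJΦ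

end TwistedHeatProxy

end Summit.AtomisticToContinuum.FouriersLaw.Theorems.BoundedResponse.HeatSpreading

end
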